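import Literature.MathematicalPhysics.QuantumFieldTheory.Balaban1983to89.B11Prop9Model

/-!
# `Balaban1983to89.B11Prop9ModelNonVacuity` — T. Bałaban, *The variational problem and background fields in renormalization group
# method for lattice gauge theories*, Commun. Math. Phys. **102** (1985) 277–309 [Balaban1985Variational], Proposition 9 (p. 309):
# NON-VACUITY of the hypothesis package of the model `B11Prop9Model` — the shared constants `GConsts.Valid`, the datum `SectGDatum`
# and its located leaves `SectGDatum.Letters` are JOINTLY SATISFIABLE (a one-site, zero-operator consistency model), so that
# `B11Prop9Model.prop9Printed_model` is a statement about an inhabited family whose premise `Reg7` holds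

statement-level skeleton of published theorems with citation tags; proofs where landed; nothing here is a claim about the Yang–Mills mass gap

WHY THIS FILE.  The model theorem `B11Prop9Model.prop9Printed_model : q.Valid → B11.Prop9Printed … (fun i => (δ i).toAnData)` carries
every analytic input of Sect. G as a field of the `Prop`-valued structure `SectGDatum.Letters V₀` (= the model's reading of «V₀ satisfies
(7)», the premise `Reg7` of `B11.Prop9Printed`), and the shared smallness / sign conditions as `GConsts.Valid`.  A vacuity audit asks
whether these packages can hold at all.  This file answers with the smallest honest witness: ONE site (𝔅 = {pt}, d ≡ 0, L = η = 1), the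
bond algebra `ℂ`, one bond, `𝒴 = 𝒵 = ℂ` with the norm as every local size (cut = identity, κ = 1), and ALL operators ZERO (G̃ = Δ⁽²⁾ =
H₀ = H = 0, (δ/δA′)V = 0, D = 0) — for which every letter holds with the constants `toyConsts` (C₁ = a₃ = A₀₂ = κ = c61 = 1, all other
letters 0; the smallness q = 0 < 1).  CONSISTENCY ONLY: the witness says nothing about Bałaban's lattice objects.

WHAT IS CERTIFIED (kernel, sorry-free; standard axioms).  `toyConsts`, `toyConsts_valid`; `toyGeometry` (one site); `normBlockNorm` (the norm
of a complex normed space as a `B11SectG.BlockNorm` over the one-site geometry); `toyDatum : SectGDatum toyConsts ℂ Unit ℂ ℂ Unit`;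
**`toyDatum_letters`** (`∀ V₀, toyDatum.Letters V₀`); **`letters_nonvacuous`** (∃ q Valid Δ, ∀ V₀, Letters V₀); **`prop9Printed_model_nonvacuous`**
(the model theorem instantiated on a family whose premise `Reg7 ε₁ V₀` holds for every ε₁, V₀ — so its conclusions are exercised, not
vacuous).  Seat pub-ymgap-dag-n07-b (HUMAN RULING D-0062, node N07 [B11]); companion of `B11Prop9Model`; imports it only.
-/

noncomputable section

namespace Literature.MathematicalPhysics.QuantumFieldTheory.Balaban1983to89.B11Prop9ModelNonVacuity

open Literature.MathematicalPhysics.QuantumFieldTheory.Balaban1983to89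
open B11SectG B11Prop9Model B6RandomWalk

/-! ## §1 The toy constants -/

/-- The toy constants: d = 0, C₁ = 1, a₃ = 1, A₀₂ = 1, κB = κN = κ3 = 1, c61 = 1, every other letter 0 (so q = κN·θ_K·c = 0 < 1).
[cite: Balaban1985Variational, Prop. 9 p.309] -/
def toyConsts : GConsts where
  d := 0
  C₁ := 1
  δ₀ := 0
  β₀ := 0
  B₀ := 0
  C₄ := 0
  a₃ := 1
  AH0 := 0
  θ₂ := 0
  AH := 0
  C₂ := 0
  κB := 1
  κN := 1
  κ3 := 1
  c61 := 1
  BG := 0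
  BG₂ := 0
  θW := 0
  cΔ := 0
  A₀ := 0
  A₀₂ := 1
  AH₂ := 0
  θD := 0

/-- The toy constants are `Valid`. [cite: Balaban1985Variational, Prop. 9 p.309] -/
theorem toyConsts_valid : toyConsts.Valid where
  C₁_pos := one_pos
  δ₀_nonneg := le_rfl
  B₀_nonneg := le_rfl
  C₄_nonneg := le_rfl
  a₃_pos := one_pos
  AH0_nonneg := le_rfl
  θ₂_nonneg := le_rfl
  AH_nonneg := le_rfl
  C₂_nonneg := le_rfl
  κB_nonneg := zero_le_one
  κN_nonneg := zero_le_one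
  κ3_nonneg := zero_le_one
  c61_nonneg := zero_le_one
  BG_nonneg := le_rfl
  BG₂_nonneg := le_rfl
  θW_nonneg := le_rfl
  cΔ_nonneg := le_rfl
  A₀_nonneg := le_rfl
  A₀₂_pos := one_pos
  AH₂_nonneg := le_rfl
  θD_nonneg := le_rfl
  q_lt_one := by norm_num [qG, thetaK, toyConsts]

/-! ## §2 The one-site geometry and the norm as a block size -/

/-- The ONE-SITE multiscale geometry: 𝔅 = {pt} at scale 0, d ≡ 0, L = η = 1, the localisation vocabulary inert (a consistency model only).
[folklore] -/
@[reducible] def toyGeometry : B6.Geometry where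
  Site := Unit
  fin := inferInstance
  scale := fun _ => 0
  dist := fun _ _ => 0
  k := 0
  eta := 1
  L := 1
  R := 0
  M := 0
  Hyp21_22 := True
  Loc := Unit
  suppIn := fun _ _ => True
  supNorm := fun _ => 0
  l2Norm := fun _ => 0
  holder := fun _ _ => 0
  Cut := Unit
  cutIn := fun _ _ => True
  cutH := fun _ _ => 0
  cutSup := fun _ => 0

/-- The norm of a complex normed space as a block size over the one-site geometry (local size = ‖·‖, cut = identity, every field
«localised», κ = 1). [folklore] -/
def normBlockNorm (F : Type) [NormedAddCommGroup F] [NormedSpace ℂ F] : BlockNorm toyGeometry F where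
  loc := fun _ f => ‖f‖
  cut := fun _ => LinearMap.id
  IsLoc := fun _ _ => True
  κ := 1
  κ_nonneg := zero_le_one
  loc_nonneg := fun _ f => norm_nonneg f
  loc_zero := fun _ => norm_zero
  loc_add_le := fun _ f f' => norm_add_le f f'
  loc_neg := fun _ f => norm_neg f
  sum_cut := fun f => by
    show ∑ _y : Unit, (LinearMap.id : F →ₗ[ℝ] F) f = f
    simp
  isLoc_cut := fun _ _ => trivial
  loc_cut_le := fun _ f => by
    show ‖(LinearMap.id : F →ₗ[ℝ] F) f‖ ≤ 1 * ‖f‖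
    simp

/-- A map that is pointwise zero has every non-negative block majorant between norm sizes. [folklore] -/
private theorem hasMaj_of_eq_zero {F₁ F₂ : Type} [NormedAddCommGroup F₁] [NormedSpace ℂ F₁] [NormedAddCommGroup F₂]
    [NormedSpace ℂ F₂] (T : F₁ →ₗ[ℝ] F₂) (hT : ∀ μ, T μ = 0) {K : Unit → Unit → ℝ} (hK : ∀ a b, 0 ≤ K a b) :
    HasMaj (normBlockNorm F₁) (normBlockNorm F₂) T K := by
  intro y' μ _ y
  show ‖T μ‖ ≤ K y y' * ‖μ‖
  rw [hT μ, norm_zero]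
  exact mul_nonneg (hK _ _) (norm_nonneg _)

/-! ## §3 The toy datum and its letters -/

/-- **The toy datum**: bond algebra `ℂ`, one bond (`ι = Unit`), `𝒴 = 𝒵 = ℂ`, data `Bdry = Unit`; G̃ = (δ/δA′)V = Δ⁽²⁾ = H₀ = H = D = 0; every
size the norm. [folklore] -/
def toyDatum : SectGDatum toyConsts ℂ Unit ℂ ℂ Unit where
  g := toyGeometry
  𝒢 := fun _ => 0
  W := fun _ _ => 0
  D2 := fun _ => 0
  H₀ := fun _ => 0
  H := fun _ => 0
  D := fun _ _ => 0
  bB := normBlockNorm (Unit → ℂ)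
  bN := normBlockNorm ℂ
  b3 := normBlockNorm ℂ
  bout := fun _ _ _ => normBlockNorm ℂ
  L_pos := one_pos
  eta_pos := one_pos
  tri := fun _ _ _ => by show (0 : ℝ) ≤ 0 + 0; norm_num
  dist_nonneg := fun _ _ => le_rfl
  rowSum := fun _ => by
    show ∑ _y' : Unit, Real.exp (-(toyConsts.δ₀ / 8 * 0)) ≤ toyConsts.c61
    simp [toyConsts]
  κB_eq := rfl
  κN_eq := rfl
  κ3_eq := rfl
  loc_le_norm := fun _ _ => le_rfl
  norm_le_loc := fun _ _ _ => le_rfl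

/-- **Every letter holds for the toy datum** (zero operators have every non-negative majorant; the zero maps are analytic and satisfy the
quadratic bounds with constant 0). [cite: Balaban1985Variational, Prop. 9 p.309] -/
theorem toyDatum_letters (V₀ : Unit) : toyDatum.Letters V₀ where
  norm_G := fun f => by simp [toyDatum, toyConsts]
  quad98 := fun Y _ => by simp [toyDatum, toyConsts]
  W_analytic := fun Y _ => by
    show AnalyticAt ℂ (fun _ : ℂ => (0 : ℂ)) Y
    exact analyticAt_const
  norm_H₀ := fun B => by simp [toyDatum, toyConsts]
  norm_D2 := fun Y => by simp [toyDatum, toyConsts]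
  norm_H := fun B => by simp [toyDatum, toyConsts]
  D_analytic := fun Y _ => by
    show AnalyticAt ℂ (fun _ : ℂ => (0 : Unit → ℂ)) Y
    exact analyticAt_const
  norm_D := fun Y _ => by simp [toyDatum, toyConsts]
  maj73 := fun Y _ => by
    refine hasMaj_of_eq_zero _ (fun μ => ?_) (fun _ _ => ?_)
    · show (fderiv ℂ (fun _ : ℂ => (0 : Unit → ℂ)) Y) μ = 0
      simp
    · show (0 : ℝ) ≤ toyConsts.θD * Real.exp (-(toyConsts.δ₀ / 2 * 0))
      simp [toyConsts]
  maj189 := fun Y _ => by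
    refine hasMaj_of_eq_zero _ (fun μ => ?_) (fun _ _ => ?_)
    · show (fderiv ℂ (fun _ : ℂ => (0 : ℂ)) Y) μ = 0
      simp
    · show (0 : ℝ) ≤ toyConsts.θW * Real.exp (-(toyConsts.δ₀ / 4 * 0))
      simp [toyConsts]
  majG := hasMaj_of_eq_zero _ (fun _ => rfl) (fun _ _ => by
    show (0 : ℝ) ≤ toyConsts.BG * Real.exp (-(toyConsts.δ₀ * 0)); simp [toyConsts])
  majG₂ := fun _ _ _ _ => hasMaj_of_eq_zero _ (fun _ => rfl) (fun _ _ => by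
    show (0 : ℝ) ≤ toyConsts.BG₂ * Real.exp (-(toyConsts.δ₀ * 0)); simp [toyConsts])
  majD2H0 := hasMaj_of_eq_zero _ (fun _ => rfl) (fun _ _ => by
    show (0 : ℝ) ≤ toyConsts.cΔ * Real.exp (-(toyConsts.δ₀ * 0)); simp [toyConsts])
  majH0 := hasMaj_of_eq_zero _ (fun _ => rfl) (fun _ _ => by
    show (0 : ℝ) ≤ toyConsts.A₀ * Real.exp (-(toyConsts.δ₀ * 0)); simp [toyConsts])
  majH0₂ := fun _ _ _ _ => hasMaj_of_eq_zero _ (fun _ => rfl) (fun _ _ => by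
    show (0 : ℝ) ≤ toyConsts.A₀₂ * Real.exp (-(toyConsts.δ₀ * 0)); simp [toyConsts])
  majH₂ := fun _ _ _ _ => hasMaj_of_eq_zero _ (fun _ => rfl) (fun _ _ => by
    show (0 : ℝ) ≤ toyConsts.AH₂ * Real.exp (-(toyConsts.δ₀ / 2 * 0)); simp [toyConsts])

/-! ## §4 Non-vacuity statements -/

/-- **The hypothesis package of `B11Prop9Model` is jointly satisfiable**: shared constants with `Valid`, a datum, and its located leaves
`Letters V₀` for every V₀. [cite: Balaban1985Variational, Prop. 9 p.309] -/
theorem letters_nonvacuous :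
    ∃ q : GConsts, q.Valid ∧ ∃ Δ : SectGDatum q ℂ Unit ℂ ℂ Unit, ∀ V₀ : Unit, Δ.Letters V₀ :=
  ⟨toyConsts, toyConsts_valid, toyDatum, toyDatum_letters⟩

/-- **`prop9Printed_model` is exercised, not vacuous**: on the toy family (one index) the typed Proposition 9 holds AND its premise
`Reg7 ε₁ V₀` (= `Letters V₀`) holds for every ε₁ and every V₀, so every conclusion of `B11.Prop9Printed` is asserted of actual data.
[cite: Balaban1985Variational, Prop. 9 p.309] -/
theorem prop9Printed_model_nonvacuous :
    ∃ q : GConsts, q.Valid ∧ ∃ Δ : SectGDatum q ℂ Unit ℂ ℂ Unit,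
      B11.Prop9Printed q.B5 q.C₁ q.β₀ q.δ₀ (fun _ : Unit => Δ.toAnData) ∧
        ∀ (ε₁ : ℝ) (V₀ : Unit), Δ.toAnData.Reg7 ε₁ V₀ :=
  ⟨toyConsts, toyConsts_valid, toyDatum, prop9Printed_model toyConsts_valid (fun _ : Unit => toyDatum),
    fun _ V₀ => toyDatum_letters V₀⟩

end Literature.MathematicalPhysics.QuantumFieldTheory.Balaban1983to89.B11Prop9ModelNonVacuity

end
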